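import Literature.Probability.LatticeModels.DobrushinShlosmanStates
import Summits.QuantumFields.YangMills.Theorems.ParabolicTrajectoryLatticeGapOnTrajectoryDefs
import Summits.QuantumFields.YangMills.Theses.ParabolicTrajectory
import Literature.Probability.LatticeModels.GibbsSpecification
import Literature.MathematicalPhysics.QuantumFieldTheory.YangMillsOS
import Mathlib.Probability.Moments.Covariance
import HarnessLib

/-!
# Crux `LatticeGapOnTrajectory`, line `orbit-kantorovich-finite-size`: stub `stub_krFiniteSizeDecay`
# (the Kantorovich finite-size ENGINE `KREngine`)

Stub of the registered skeleton of crux `stmt-QuantumFields-10523`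
(`Summit.QuantumFields.YangMills.Theses.ParabolicTrajectory.LatticeGapOnTrajectory`); vocabulary from
`…LatticeGapOnTrajectoryDefs`; the generic comparison machinery is the Literature series
`Literature/Probability/LatticeModels/DobrushinShlosman*.lean`.

PLAN (Dobrushin 1970 / Föllmer 1988 Ch. I §2 with one-WINDOW updates and CELL-indexed Lipschitz vectors;
the vocabulary-free layers are the tree files
`Literature/Probability/LatticeModels/DobrushinShlosman{Comparison,Contraction,WindowDusting,States}.lean`,
theorems over explicit data in `namespace Literature.Probability.LatticeModels.DobrushinShlosman`).
(1) Cell-Lipschitz vectors and the interpolation bound `|f σ - f τ| ≤ R Σ_c δ c`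
(`DobrushinShlosman.abs_sub_le_sum_cells`). (2) Window dusting (`DobrushinShlosman.lip_windowAvg`):
`γ_{W(c)} f` has the vector `0` on the window and `δ y + Σ_{x ∈ W(c)} k c y x δ x` off it (properness, locality of `w`,
`contract` on the shell, `range` beyond). (3) Estimates, the single-window update and the AVERAGED step
(weight `ε/|ι|` on every usable centre; convex combinations of estimates are estimates). The received-sum
hypothesis `sum_le` only controls the average over all `(2n+1)⁴` centres around a cell, and near `Δg` only
some of them are usable, so the averaged step can INCREASE the estimate there; the contraction is therefore
proved in the time-dependent three-zone form `(step^m R) x ≤ R (G^m θ^{ℓ x} + β^m)`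
(`DobrushinShlosman.iterate_step_le`: growth budget `G = 1 + ε(2γ₀N⋆+1)/|ι|` on the zone `ℓ = 0`, decay
`β = 1 - ε(1-γ₀)/|ι|` of the unresampled mass, standing profile `θ = e^{γ₀-1} ≥ γ₀` in the bulk); after
`|ι| L₀` steps with `ε = (1-γ₀)/(2(2γ₀N⋆+1))` both terms are `≤ e^{-κ₁ L₀}`,
`κ₁ = (1-γ₀)²/(2(2γ₀N⋆+1))`, free of `|ι|` (`DobrushinShlosman.abs_sub_le_exp`). (4) States: the Gibbs expectation
(DLR) and its tilt by `g̃ = g - g(τ₀) + RΣδ_g ≥ 0` (invariant under windows avoiding `Δg`); covariance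
assembly as in the tree's `abs_covariance_le_of_isKRContraction` (`DobrushinShlosman.abs_covariance_le`).

This file is the torus-geometric instance: cells = the coarse 4-torus, windows = `ℓ^∞` balls of radius `n`
(site sets `windowVol`), shells = spheres of radius `n + 1` (the `range` clause kills the influence of
farther cells, so the coefficients are `k` restricted to the shell), `N⋆ = (2n+1)⁴`
(`card_filter_cdist_le`, no assumption on the torus size), profile `ℓ x = ⌊cdist(x, Δg)/(2n+2)⌋`
(`profile_usable`, `profile_lipschitz`); whence `κ = κ₁/(2n+2)` and `C₀ = 4R² e^{κ₁}`.
-/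

namespace Summit.QuantumFields.YangMills.Cruxes.LatticeGapOnTrajectory.OrbitKantorovichFiniteSize
open scoped BigOperators Topology ENNReal ProbabilityTheory
open Filter MeasureTheory
open Literature.Probability.LatticeModels (Specification IsSpecification IsGibbsMeasure glueWith)
open Literature.MathematicalPhysics.QuantumFieldTheory
noncomputable section

namespace KRFiniteSize

/-! ### The coarse distance -/

section CoarseDistance

variable {μ : Fin 4 → ℕ}

/-- Each axis contributes at most the coarse distance. [folklore] -/
theorem natAbs_valMinAbs_le_cdist (x y : CoarseIdx μ) (i : Fin 4) :
    ((x i - y i).valMinAbs).natAbs ≤ cdist x y :=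
  Finset.le_sup (f := fun i : Fin 4 => ((x i - y i).valMinAbs).natAbs) (Finset.mem_univ i)

/-- The coarse distance is symmetric. [folklore] -/
theorem cdist_comm (x y : CoarseIdx μ) : cdist x y = cdist y x := by
  unfold cdist
  congr 1
  funext i
  rw [← ZMod.natAbs_valMinAbs_neg, neg_sub]

/-- The coarse distance of a cell to itself vanishes. [folklore] -/
theorem cdist_self (x : CoarseIdx μ) : cdist x x = 0 := by
  unfold cdist
  simp [ZMod.valMinAbs_zero]

/-- The coarse distance satisfies the triangle inequality (axiswise: the minimal representative of a sum is
at most the sum of the minimal representatives in absolute value). [folklore] -/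
theorem cdist_triangle (x y z : CoarseIdx μ) : cdist x z ≤ cdist x y + cdist y z := by
  unfold cdist
  refine Finset.sup_le fun i _ => ?_
  have e : x i - z i = (x i - y i) + (y i - z i) := by abel
  calc ((x i - z i).valMinAbs).natAbs
      ≤ ((x i - y i).valMinAbs + (y i - z i).valMinAbs).natAbs := by
        rw [e]; exact ZMod.natAbs_valMinAbs_add_le _ _
    _ ≤ ((x i - y i).valMinAbs).natAbs + ((y i - z i).valMinAbs).natAbs := Int.natAbs_add_le _ _
    _ ≤ _ := add_le_add (natAbs_valMinAbs_le_cdist x y i) (natAbs_valMinAbs_le_cdist y z i)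

/-- **Bounded covering number**: at most `(2n+1)⁴` cells lie within coarse distance `n` of a given cell
(the axiswise minimal representatives inject the ball into the box `[-n, n]⁴`; no assumption on the torus
size). [folklore] -/
theorem card_filter_cdist_le (n : ℕ) (x : CoarseIdx μ) :
    (Finset.univ.filter fun c : CoarseIdx μ => cdist c x ≤ n).card ≤ (2 * n + 1) ^ 4 := by
  let φ : CoarseIdx μ → (Fin 4 → ℤ) := fun c i => (c i - x i).valMinAbs
  have hinj : Function.Injective φ := by
    intro c c' h
    funext i
    have hi : (c i - x i).valMinAbs = (c' i - x i).valMinAbs := congrFun h i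
    exact sub_left_injective (ZMod.valMinAbs_inj.1 hi)
  calc (Finset.univ.filter fun c : CoarseIdx μ => cdist c x ≤ n).card
      ≤ (Fintype.piFinset fun _ : Fin 4 => Finset.Icc (-(n : ℤ)) n).card := by
        refine Finset.card_le_card_of_injOn φ (fun c hc => ?_) hinj.injOn
        rw [Finset.mem_coe, Fintype.mem_piFinset]
        intro i
        have h : ((c i - x i).valMinAbs).natAbs ≤ n :=
          (natAbs_valMinAbs_le_cdist c x i).trans (Finset.mem_filter.1 (Finset.mem_coe.1 hc)).2
        have h' : |(c i - x i).valMinAbs| ≤ n := by rw [Int.abs_eq_natAbs]; exact_mod_cast h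
        exact Finset.mem_Icc.2 (abs_le.1 h')
    _ = (2 * n + 1) ^ 4 := by
        rw [Fintype.card_piFinset, Finset.prod_const, Finset.card_univ, Fintype.card_fin, Int.card_Icc]
        congr 1
        omega

end CoarseDistance

/-! ### The KR window package read as window comparison data -/

section Instance

variable {μ : Fin 4 → ℕ} {V S : Type} [Fintype V] [MeasurableSpace S] {cell : V → CoarseIdx μ}
  {w : CoarseIdx μ → (V → S) → (V → S) → ℝ} {γ : Specification V S} {R : ℝ} {n : ℕ} {γ₀ : ℝ}
  {k : CoarseIdx μ → CoarseIdx μ → CoarseIdx μ → ℝ}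

/-- The ball of centres around `x` written through membership in the window cell sets. [folklore] -/
theorem filter_mem_ball_eq (n : ℕ) (x : CoarseIdx μ) :
    (Finset.univ.filter fun c : CoarseIdx μ => x ∈ Finset.univ.filter fun z => cdist c z ≤ n) =
      Finset.univ.filter fun c : CoarseIdx μ => cdist c x ≤ n := by
  ext c
  simp

/-- **The contraction hypothesis of the window comparison** from the KR window package: windows = coarse
balls of radius `n` (site sets `windowVol`), coefficients = `k` restricted to the shell `cdist c y = n + 1`;
`IsKRWindow.contract` on the shell and `IsKRWindow.range` beyond it. [cite: DobrushinShlosman1985, Theorem] -/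
theorem contract_of_isKRWindow (hKR : IsKRWindow cell w γ R n γ₀ k) (c y : CoarseIdx μ)
    (hy : y ∉ Finset.univ.filter fun z => cdist c z ≤ n) (ω η : V → S)
    (hωη : ∀ v, cell v ≠ y → ω v = η v) (f : (V → S) → ℝ) (δ : CoarseIdx μ → ℝ) (hfm : Measurable f)
    (hfB : ∃ B, ∀ σ, |f σ| ≤ B)
    (hdep : DependsOn f {v | cell v ∈ Finset.univ.filter fun z => cdist c z ≤ n}) (hδ0 : ∀ x, 0 ≤ δ x)
    (hδ : ∀ (x : CoarseIdx μ) (σ τ : V → S), (∀ v, cell v ≠ x → σ v = τ v) →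
      |f σ - f τ| ≤ δ x * w x σ τ) :
    |∫ σ, f σ ∂(γ (windowVol cell n c) ω) - ∫ σ, f σ ∂(γ (windowVol cell n c) η)| ≤
      (∑ x ∈ Finset.univ.filter (fun z => cdist c z ≤ n),
        (if cdist c y = n + 1 then k c y x else 0) * δ x) * w y ω η := by
  have hy' : n < cdist c y := by simpa [Finset.mem_filter] using hy
  have hdep' : DependsOn f {v | cdist c (cell v) ≤ n} := by simpa [Finset.mem_filter] using hdep
  rcases (Nat.succ_le_of_lt hy').eq_or_lt with heq | hlt
  · -- the shell: the contraction clause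
    have h := hKR.contract c y hy' ω η hωη f δ hfm hfB hdep' ⟨hδ0, hδ⟩
    have hs : ∑ x ∈ Finset.univ.filter (fun z => cdist c z ≤ n),
        (if cdist c y = n + 1 then k c y x else 0) * δ x =
        ∑ x ∈ Finset.univ.filter (fun z => cdist c z ≤ n), k c y x * δ x :=
      Finset.sum_congr rfl fun x _ => by rw [if_pos heq.symm]
    rw [hs]
    exact h
  · -- beyond the shell: the range clause
    have h := hKR.range c y hlt ω η hωη f hfm hfB hdep'
    have hs : ∑ x ∈ Finset.univ.filter (fun z => cdist c z ≤ n),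
        (if cdist c y = n + 1 then k c y x else 0) * δ x = 0 :=
      Finset.sum_eq_zero fun x _ => by rw [if_neg (by omega), zero_mul]
    rw [hs, zero_mul]
    change |windowAvg γ (windowVol cell n c) f ω - windowAvg γ (windowVol cell n c) f η| ≤ 0
    rw [h, sub_self, abs_zero]

/-- **The received-sum hypothesis** of the window comparison is `IsKRWindow.sum_le` (the shell-restricted
coefficients summed over all cells equal the shell sums). [folklore] -/
theorem sum_ball_le (hKR : IsKRWindow cell w γ R n γ₀ k) (x : CoarseIdx μ) :
    ∑ c ∈ Finset.univ.filter (fun c : CoarseIdx μ => x ∈ Finset.univ.filter fun z => cdist c z ≤ n),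
        ∑ y, (if cdist c y = n + 1 then k c y x else 0) ≤
      γ₀ * (Finset.univ.filter fun c : CoarseIdx μ =>
        x ∈ Finset.univ.filter fun z => cdist c z ≤ n).card := by
  rw [filter_mem_ball_eq]
  refine le_of_eq_of_le (Finset.sum_congr rfl fun c _ => ?_) (hKR.sum_le x)
  rw [Finset.sum_filter]

omit [Fintype V] [MeasurableSpace S] in
/-- At most `(2n+1)⁴` centres around any cell. [folklore] -/
theorem card_ball_le (n : ℕ) (x : CoarseIdx μ) :
    (Finset.univ.filter fun c : CoarseIdx μ => x ∈ Finset.univ.filter fun z => cdist c z ≤ n).card ≤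
      (2 * n + 1) ^ 4 := by
  rw [filter_mem_ball_eq]
  exact card_filter_cdist_le n x

/-! ### The profile `ℓ x = ⌊cdist(x, Δg) / (2n+2)⌋` -/

omit [Fintype V] [MeasurableSpace S] in
/-- **Windows around cells of positive profile avoid `Δg`**: if `⌊d(x)/(2n+2)⌋ ≠ 0` (`d` = coarse distance
to `Δg`) then every window containing `x` misses `Δg` (triangle inequality). [folklore] -/
theorem profile_usable {Δg : Finset (CoarseIdx μ)} (hne : Δg.Nonempty) (n : ℕ) (x : CoarseIdx μ)
    (hx : Δg.inf' hne (fun z => cdist x z) / (2 * n + 2) ≠ 0) (c : CoarseIdx μ)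
    (hxc : x ∈ Finset.univ.filter fun z => cdist c z ≤ n) (z : CoarseIdx μ)
    (hz : z ∈ Finset.univ.filter fun z => cdist c z ≤ n) : z ∉ Δg := by
  intro hzΔ
  have hxc' : cdist c x ≤ n := by simpa using hxc
  have hz' : cdist c z ≤ n := by simpa using hz
  have hd : 2 * n + 2 ≤ Δg.inf' hne (fun z => cdist x z) := by
    by_contra hlt
    exact hx (Nat.div_eq_of_lt (not_le.1 hlt))
  have h1 : Δg.inf' hne (fun z => cdist x z) ≤ cdist x z := Finset.inf'_le _ hzΔ
  have h2 : cdist x z ≤ cdist x c + cdist c z := cdist_triangle x c z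
  rw [cdist_comm x c] at h2
  omega

omit [Fintype V] [MeasurableSpace S] in
/-- **The profile drops by at most one along an influence**: if `x` is a window cell of the centre `c` and
the shell-restricted coefficient is nonzero at the boundary cell `y`, then `cdist x y ≤ 2n+1`, so
`⌊d(x)/(2n+2)⌋ ≤ ⌊d(y)/(2n+2)⌋ + 1`. [folklore] -/
theorem profile_lipschitz {Δg : Finset (CoarseIdx μ)} (hne : Δg.Nonempty) (n : ℕ) (c x y : CoarseIdx μ)
    (hxc : x ∈ Finset.univ.filter fun z => cdist c z ≤ n)
    (hk : (if cdist c y = n + 1 then k c y x else 0) ≠ 0) :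
    Δg.inf' hne (fun z => cdist x z) / (2 * n + 2) ≤
      Δg.inf' hne (fun z => cdist y z) / (2 * n + 2) + 1 := by
  have hxc' : cdist c x ≤ n := by simpa using hxc
  have hcy : cdist c y = n + 1 := by
    by_contra hne'
    exact hk (by rw [if_neg hne'])
  have hxy : cdist x y ≤ 2 * n + 1 := by
    have := cdist_triangle x c y; rw [cdist_comm x c] at this; omega
  -- `d(x) ≤ d(y) + cdist x y`
  obtain ⟨z₀, hz₀, hdz₀⟩ := Finset.exists_mem_eq_inf' hne fun z => cdist y z
  have hdx : Δg.inf' hne (fun z => cdist x z) ≤ Δg.inf' hne (fun z => cdist y z) + (2 * n + 2) := by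
    calc Δg.inf' hne (fun z => cdist x z) ≤ cdist x z₀ := Finset.inf'_le _ hz₀
      _ ≤ cdist x y + cdist y z₀ := cdist_triangle x y z₀
      _ ≤ Δg.inf' hne (fun z => cdist y z) + (2 * n + 2) := by rw [hdz₀]; omega
  calc Δg.inf' hne (fun z => cdist x z) / (2 * n + 2)
      ≤ (Δg.inf' hne (fun z => cdist y z) + (2 * n + 2)) / (2 * n + 2) := Nat.div_le_div_right hdx
    _ = Δg.inf' hne (fun z => cdist y z) / (2 * n + 2) + 1 := Nat.add_div_right _ (by omega)

end Instance

end KRFiniteSize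

/-! ### The engine -/

open KRFiniteSize in
/-- **The Dobrushin–Shlosman / Kantorovich finite-size engine** (`KREngine`): for window radius `n`, ratio
`γ₀ ∈ [0, 1)` and weight bound `R ≥ 0`, with `N⋆ = (2n+1)⁴` and `κ₁ = (1-γ₀)²/(2(2γ₀N⋆+1))`, the
constants `κ = κ₁/(2n+2)`, `C₀ = 4R² e^{κ₁}` work: on every coarse 4-torus, for every specification
satisfying the KR window package and every Gibbs measure, `|cov(f, g)| ≤ C₀ (Σδ_f)(Σδ_g) e^{-κ D}` for
bounded measurable cell-local cell-Lipschitz `f, g` at coarse distance `≥ D` — Dobrushin–Shlosman 1985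
(`C_V` ⇒ exponential decay) through Föllmer's dual-Lipschitz comparison with windows
(`DobrushinShlosman.abs_covariance_le`) and the profile `⌊cdist(·, Δg)/(2n+2)⌋`. The no-wrap hypothesis
`2n+3 ≤ μ i + 1` is not needed. [cite: DobrushinShlosman1985, Theorem] -/
theorem stub_krFiniteSizeDecay : KREngine := by
  intro n γ₀ R hγ₀ hγ₁ hR
  set Nstar : ℕ := (2 * n + 1) ^ 4 with hNstar
  set κ₁ : ℝ := (1 - γ₀) ^ 2 / (2 * (2 * γ₀ * Nstar + 1)) with hκ₁
  have hκ₁pos : 0 < κ₁ := by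
    rw [hκ₁]
    have : 0 < 1 - γ₀ := by linarith
    positivity
  have h2n : (0 : ℝ) < 2 * n + 2 := by positivity
  refine ⟨κ₁ / (2 * n + 2), 4 * R ^ 2 * Real.exp κ₁, div_pos hκ₁pos h2n, by positivity, ?_⟩
  intro μ V S _ _ cell w γ k _ hγ hKR ν hν f g Δf Δg δf δg D hfm hgm hfB hgB hfdep hgdep hδf hδg hD
  classical
  haveI := hν.isProbabilityMeasure
  have hSf : 0 ≤ ∑ x ∈ Δf, δf x := Finset.sum_nonneg fun x _ => hδf.nonneg x
  have hSg : 0 ≤ ∑ y ∈ Δg, δg y := Finset.sum_nonneg fun y _ => hδg.nonneg y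
  have hRHS : 0 ≤ 4 * R ^ 2 * Real.exp κ₁ * (∑ x ∈ Δf, δf x) * (∑ y ∈ Δg, δg y) *
      Real.exp (-(κ₁ / (2 * n + 2) * D)) := by positivity
  rcases Δg.eq_empty_or_nonempty with hΔg | hne
  · -- `g` reads no cell: it is constant and the covariance vanishes
    obtain ⟨τ₀, -⟩ := nonempty_of_measure_ne_zero (μ := ν) (s := Set.univ) (by simp)
    have hg : g = fun _ => g τ₀ := funext fun σ => hgdep fun v hv => by simp [hΔg] at hv
    rw [hg, ProbabilityTheory.covariance_const_right, abs_zero]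
    exact hRHS
  -- the profile and the window comparison theorem on coarse balls
  set ℓ : CoarseIdx μ → ℕ := fun x => Δg.inf' hne (fun z => cdist x z) / (2 * n + 2) with hℓ
  set L₀ : ℕ := D / (2 * n + 2) with hL₀
  obtain ⟨Bf, hBf⟩ := hfB
  obtain ⟨Bg, hBg⟩ := hgB
  have hL : ∀ x ∈ Δf, L₀ ≤ ℓ x := fun x hx =>
    Nat.div_le_div_right ((Finset.le_inf'_iff hne _).2 fun z hz => hD x hx z hz)
  have hfdep' : DependsOn f {v | cell v ∈ Δf} := hfdep
  have hgdep' : DependsOn g {v | cell v ∈ Δg} := hgdep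
  have key := Literature.Probability.LatticeModels.DobrushinShlosman.abs_covariance_le (Λ := windowVol cell n)
    (win := fun c => Finset.univ.filter fun z => cdist c z ≤ n)
    (k := fun c y x => if cdist c y = n + 1 then k c y x else 0) hR hKR.w_le hKR.w_local hγ
    (fun c v => by simp [windowVol]) (fun c y x => by
      split_ifs; exacts [hKR.k_nonneg c y x, le_rfl])
    (fun c y hy ω η hωη f' δ hf'm hf'B hdep hδ0 hδ => contract_of_isKRWindow hKR c y hy ω η hωη f' δ
      hf'm hf'B hdep hδ0 hδ)
    hγ₀ hγ₁ (Nstar := Nstar) (sum_ball_le hKR) (card_ball_le n) (fun x => by simp [cdist_self])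
    hν hfm hgm hBf hBg hfdep' hgdep' hδf.nonneg hδf.le hδg.nonneg hδg.le ℓ L₀
    (fun x hx c hxc z hz => profile_usable hne n x hx c hxc z hz)
    (fun c x y hxc hk => profile_lipschitz hne n c x y hxc hk) hL
  -- `e^{-κ₁ L₀} ≤ e^{κ₁} e^{-κ D}` since `L₀ + 1 > D / (2n+2)`
  have hL₀ : (D : ℝ) / (2 * n + 2) < L₀ + 1 := by
    rw [div_lt_iff₀ h2n]
    have h := Nat.lt_mul_div_succ D (by omega : 0 < 2 * n + 2)
    have h' : (D : ℝ) < (2 * n + 2 : ℕ) * (L₀ + 1 : ℕ) := by exact_mod_cast h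
    push_cast at h'
    linarith
  have hexp : Real.exp (-(κ₁ * L₀)) ≤ Real.exp κ₁ * Real.exp (-(κ₁ / (2 * n + 2) * D)) := by
    rw [← Real.exp_add, Real.exp_le_exp]
    have : κ₁ / (2 * n + 2) * D = κ₁ * (D / (2 * n + 2)) := by ring
    rw [this]
    nlinarith
  calc |cov[f, g; ν]| ≤ 4 * R ^ 2 * Real.exp (-(κ₁ * L₀)) * (∑ x ∈ Δf, δf x) * ∑ y ∈ Δg, δg y := key
    _ ≤ 4 * R ^ 2 * (Real.exp κ₁ * Real.exp (-(κ₁ / (2 * n + 2) * D))) *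
        (∑ x ∈ Δf, δf x) * ∑ y ∈ Δg, δg y := by gcongr
    _ = 4 * R ^ 2 * Real.exp κ₁ * (∑ x ∈ Δf, δf x) * (∑ y ∈ Δg, δg y) *
        Real.exp (-(κ₁ / (2 * n + 2) * D)) := by ring

end

end Summit.QuantumFields.YangMills.Cruxes.LatticeGapOnTrajectory.OrbitKantorovichFiniteSize
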